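import Literature.NumberTheory.EllipticCurves.GreenbergSelmerDualDataExistsProofs
import Literature.NumberTheory.EllipticCurves.CharacterModuleQuotientDualityProofs
import Literature.NumberTheory.EllipticCurves.IwasawaEulerCharDualityProofs
import Summits.BirchSwinnertonDyer.BirchSwinnertonDyer.Theorems.ResidualThetaTransportAtTwoLambdaLowerBoundO
import HarnessLib

/-!
# The Pontryagin brick of S2: `#𝒮[ϖ] ≥ #Sg[ϖ] = #(X/ϖX) ≥ q^{rank_𝒪 X}` for a scalar-stable subgroup
# `Sg` of `H¹(K_∞, A)` inside a counted set `𝒮`, `X` any `Λ_𝒪`-dual of `Sg` — crux (R≥)ᵖ, line «bt26-lambda»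

Route `ResidualThetaTransportAtTwo` (RTT), crux (R≥)ᵖ `ResidualThetaCountLowerPureAtTwo`
(stmt-BirchSwinnertonDyer-26074), skeleton of record `Cruxes/ResidualThetaCountLowerPureAtTwo/Lines/bt26_lambda.lean`,
stub S2 `stub_cmLambdaLower` (the hardest, research-grade stub). Seat `prover-bsd-rtt-w2` g0 (RTT width 2 of
director-bsd g13 (195); `--supports`, closes nothing). HONEST FRAMING: THEOREMS ONLY (no definition, no named
fact, no instance, no `sorry`); nothing here is specific to the CM form `g`, to `p = 2`, or to any L-function;
BSD is not proved by any of this, and S2 is NOT proved by this file.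

WHAT S2 IS, AFTER THIS FILE. S2 concludes `#(𝒪/ϖ)^(d + Σ_g(S₀)) ≤ #𝒮[ϖ]` for the transported
`S₀`-imprimitive plus-Selmer SET `𝒮 ⊆ H¹(ℚ_∞, A_g)` of the skeleton (given `𝒮[ϖ]` finite). The design memo
`LINE-DESIGN-g11.md` §2 splits it as (f) «`𝒪`-corank of `Sel⁺_{S₀}(ℚ_∞, A_g)` ≥ `d + Σ_g(S₀)`» (PORT + CITE:
BT26 Thm 2.6, Kato §12, Kobayashi §6–§8 ⊗ 𝒪, Greenberg–Vatsal) and (g) «`#Sel[ϖ] = #(X/ϖX)` (Pontryagin) and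
`q^{rank_𝒪 X} ≤ #(X/ϖX)`». The second half of (g) is the landed brick
`LambdaLowerBoundO.pow_finrank_le_natCard_quotient_of_iwasawaAlgebraO` (p624860). THIS FILE is the first half
of (g) and the assembly of (g), written so that it applies to the skeleton's SET `𝒮` verbatim: for ANY additive
subgroup `Sg ≤ H¹(K_∞, A)` (`A = Fⁿ/𝒪ⁿ`, `F = ℚ_p(S)`, `𝒪 = 𝒪_F`, `Γ_K` acting through a framed `ρ`) that is
stable under the scalars `𝒪` (`scalarH1`) and contained in a set `𝒮`, and ANY Pontryagin-dual pair
`toDual : X ≅ Hom(Sg, ℚ/ℤ)` in which the constants act through `scalarH1` (the convention of the tree's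
`GreenbergSelmer.DualData.toDual_C_smul`):

* §1 `natCard_quotient_eq_ncard_of_dualPair` — **`#(X/ϖX) = #{c ∈ Sg | ϖ·c = 0}`** for every `ϖ ∈ 𝒪`
  (`PontryaginCard.exists_quotSMulTop_addEquiv_characterModule_ker` with `q = ϖ`, `ψ = scalarH1 ϖ|_{Sg}`, and
  `#Hom(B, ℚ/ℤ) = #B`);
* §2 `pow_finrank_le_ncard_of_dualPair` — if moreover `X` is a finitely generated `Λ_𝒪 = 𝒪⟦T⟧`-module (with
  its `𝒪`-structure, constants acting as `PowerSeries.C a`) and `{c ∈ Sg | ϖ·c = 0}` is finite for a uniformiser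
  `ϖ`, then `X` is finitely generated over `𝒪` («`μ = 0` for free») and
  **`#(𝒪/ϖ)^{rank_𝒪(X/X_tors)} ≤ #{c ∈ Sg | ϖ·c = 0}`** (p624860 + §1);
* §3 `pow_le_ncard_of_dualPair_of_subset` — **the shape S2 consumes**: for `Sg ⊆ 𝒮` and
  `m ≤ rank_𝒪(X/X_tors)`, finiteness of `{c ∈ 𝒮 | ϖ·c = 0}` gives `#(𝒪/ϖ)^m ≤ #{c ∈ 𝒮 | ϖ·c = 0}`;
* §4 `exists_dualPair_of_stable` — NON-VACUITY of the dual-pair hypothesis: for `Sg` stable under `conj_γ`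
  (`γ` a topological generator of `Γ = Gal(K_∞/K)`) and under the scalars, `X = Hom(Sg, ℚ/ℤ)` carries a
  `Λ_𝒪`-module structure with `T = conj_γ − 1` and constants through `scalarH1`, together with the
  `𝒪`-structure through `PowerSeries.C` forming a scalar tower (the proof of the tree's
  `GreenbergSelmer.nonempty_dualData`, p. Greenberg 1989 §1 / EPW §3.1, for an arbitrary stable subgroup in
  place of Greenberg's Selmer group).

So after this file S2 reads: «there is a scalar-stable subgroup `Sg` of the transported plus-Selmer set `𝒮`
(e.g. `𝒮` itself once its `𝒪`-stability is proved — integral Schur at `2`, width w3's (H4)) some — equivalently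
every — `Λ_𝒪`-dual of which is finitely generated over `Λ_𝒪` with `rank_𝒪 ≥ d + Σ_g(S₀)`», i.e. exactly the
`𝒪`-CORANK statement (f) of the memo; the Pontryagin/Nakayama/counting glue is kernel-checked here.

References: [GreenbergLNM1716] §1 (PDF p. 60), §4 p. 98; [Greenberg1989] §1 p. 98; [EmertonPollackWeston2006]
§3.1, Thm. 3.1.1 («`λ^alg(f) = dim_k Sel(ℚ_∞, A_f)[π]`» when `μ^alg(f) = 0`); [Washington1997] §13.2.
-/

set_option autoImplicit false
-- the Theorems namespace of this sub repeats the summit name by design (D-0017 nested layout)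
set_option linter.dupNamespace false

noncomputable section

open scoped Classical

namespace Summit.BirchSwinnertonDyer.BirchSwinnertonDyer.Theorems.LambdaLowerBoundO

open Literature.NumberTheory.EllipticCurves Literature.NumberTheory.EllipticCurves.GreenbergSelmer
open Literature.NumberTheory.GaloisRepresentations NumberField IsDedekindDomain Field

universe w

section DualPair

variable {p : ℕ} [Fact p.Prime] {K : Type} [Field K] (S : Set (PadicAlgCl p)) {n : ℕ}
  (κ : ZpExtension K p) (ρ : FramedGaloisRep K (padicCoeffIntegers S) n)
  (Sg : AddSubgroup (subgroupH1 κ.kerSubgroup (Cofree ρ (padicCoeffField S))))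
  (hscal : ∀ (r : padicCoeffIntegers S) {c : subgroupH1 κ.kerSubgroup (Cofree ρ (padicCoeffField S))},
    c ∈ Sg → scalarH1 κ.kerSubgroup (Cofree ρ (padicCoeffField S)) r c ∈ Sg)

/-! ### §1. Pontryagin: `#(X/ϖX) = #Sg[ϖ]` for a dual pair -/

include hscal in
/-- **`#(X/ϖX) = #{c ∈ Sg | ϖ·c = 0}`.** Let `Sg ≤ H¹(K_∞, A)` (`A = Fⁿ/𝒪ⁿ`, `F = ℚ_p(S)`, `𝒪 = 𝒪_F`) be an
additive subgroup stable under the scalars `𝒪` (`scalarH1`), and `toDual : X → Hom(Sg, ℚ/ℤ)` a bijective additive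
map from an `𝒪`-module `X` in which `a ∈ 𝒪` acts as the transpose of `scalarH1 a` (the convention
`GreenbergSelmer.DualData.toDual_C_smul`). Then for every `ϖ ∈ 𝒪` the quotient `X/ϖX` has exactly as many
elements as the `ϖ`-torsion `{c ∈ Sg | scalarH1 ϖ c = 0}` (as `Nat.card` / `Set.ncard`: both are `0` when
infinite). Greenberg: «`X/θ X` is the Pontryagin dual of the `θ`-torsion» (restriction of characters,
`PontryaginCard.exists_quotSMulTop_addEquiv_characterModule_ker`) and `#Hom(B, ℚ/ℤ) = #B`.
[cite: GreenbergLNM1716, §4 p. 98] [cite: EmertonPollackWeston2006, §3.1] -/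
theorem natCard_quotient_eq_ncard_of_dualPair (X : Type w) [AddCommGroup X]
    [Module (padicCoeffIntegers S) X]
    (toDual : X →+ (Sg →+ AddCircle (1 : ℚ))) (hbij : Function.Bijective toDual)
    (hC : ∀ (a : padicCoeffIntegers S) (x : X) (s : Sg),
      toDual (a • x) s = toDual x ⟨scalarH1 κ.kerSubgroup (Cofree ρ (padicCoeffField S)) a s, hscal a s.2⟩)
    (ϖ : padicCoeffIntegers S) :
    Nat.card (X ⧸ ((Ideal.span {ϖ} : Ideal (padicCoeffIntegers S)) • (⊤ : Submodule (padicCoeffIntegers S) X))) =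
      {c : subgroupH1 κ.kerSubgroup (Cofree ρ (padicCoeffField S)) |
        c ∈ Sg ∧ scalarH1 κ.kerSubgroup (Cofree ρ (padicCoeffField S)) ϖ c = 0}.ncard := by
  -- `ψ = scalarH1 ϖ` restricted to `Sg`
  let ψ : Sg →+ Sg :=
    ((scalarH1 κ.kerSubgroup (Cofree ρ (padicCoeffField S)) ϖ).restrict Sg).codRestrict Sg
      fun s ↦ hscal ϖ s.2
  have hψ : ∀ s : Sg, ((ψ s : Sg) : subgroupH1 κ.kerSubgroup (Cofree ρ (padicCoeffField S))) =
      scalarH1 κ.kerSubgroup (Cofree ρ (padicCoeffField S)) ϖ s := fun _ ↦ rfl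
  have hq : ∀ (x : X) (s : Sg), (toDual : X →+ CharacterModule Sg) (ϖ • x) s =
      (toDual : X →+ CharacterModule Sg) x (ψ s) := by
    intro x s
    rw [hC]
    rfl
  obtain ⟨Ψ, -⟩ := PontryaginCard.exists_quotSMulTop_addEquiv_characterModule_ker
    (toDual : X →+ CharacterModule Sg) hbij ϖ ψ hq
  rw [PontryaginCard.natCard_eq_of_addEquiv_characterModule Ψ, ← Nat.card_coe_set_eq]
  -- `ker ψ ≃ {c ∈ Sg | ϖ·c = 0}`
  have hmem : ∀ s : ψ.ker, ((s : Sg) : subgroupH1 κ.kerSubgroup (Cofree ρ (padicCoeffField S))) ∈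
      {c : subgroupH1 κ.kerSubgroup (Cofree ρ (padicCoeffField S)) |
        c ∈ Sg ∧ scalarH1 κ.kerSubgroup (Cofree ρ (padicCoeffField S)) ϖ c = 0} := by
    intro s
    refine ⟨(s : Sg).2, ?_⟩
    have h : ψ (s : Sg) = 0 := (AddMonoidHom.mem_ker).mp s.2
    rw [← hψ, h]
    rfl
  have hmem' : ∀ c : {c : subgroupH1 κ.kerSubgroup (Cofree ρ (padicCoeffField S)) |
      c ∈ Sg ∧ scalarH1 κ.kerSubgroup (Cofree ρ (padicCoeffField S)) ϖ c = 0},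
      (⟨c.1, c.2.1⟩ : Sg) ∈ ψ.ker := by
    intro c
    rw [AddMonoidHom.mem_ker]
    exact Subtype.ext c.2.2
  exact Nat.card_congr
    { toFun := fun s ↦ ⟨_, hmem s⟩
      invFun := fun c ↦ ⟨_, hmem' c⟩
      left_inv := fun s ↦ rfl
      right_inv := fun c ↦ rfl }

/-! ### §2. `q^{rank_𝒪 X} ≤ #Sg[ϖ]` for a finitely generated `Λ_𝒪`-dual -/

include hscal in
/-- **`#(𝒪/ϖ)^{rank_𝒪(X/X_tors)} ≤ #{c ∈ Sg | ϖ·c = 0}`, and `X` is finitely generated over `𝒪`.** In the setting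
of `natCard_quotient_eq_ncard_of_dualPair`, suppose `X` is a finitely generated module over
`Λ_𝒪 = IwasawaAlgebraO S = 𝒪⟦T⟧` carrying the `𝒪`-structure of a scalar tower, the constants `a ∈ 𝒪` acting on
`Hom(Sg, ℚ/ℤ)` through `scalarH1 a` (`toDual (C a • x) s = toDual x (a·s)`, the `toDual_C_smul` convention), that
`ϖ` is a uniformiser of `𝒪` and that the `ϖ`-torsion `{c ∈ Sg | ϖ·c = 0}` is FINITE. Then `X/ϖX` is finite
(§1), hence (complete Nakayama, p624860) `X` is finitely generated over `𝒪` — `μ = 0` is a CONSEQUENCE, not an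
input — and `#(𝒪/ϖ)^{rank_𝒪(X/X_tors)} ≤ #(X/ϖX) = #{c ∈ Sg | ϖ·c = 0}`. (EPW Thm. 3.1.1: «if `μ^alg = 0` then
`λ^alg = dim_k Sel[π]`»; here only the inequality the crux needs, for an arbitrary stable subgroup.)
[cite: EmertonPollackWeston2006, Thm. 3.1.1] [cite: Washington1997, §13.2] [cite: GreenbergLNM1716, §4 p. 98] -/
theorem pow_finrank_le_ncard_of_dualPair [FiniteDimensional ℚ_[p] (padicCoeffField S)]
    (X : Type w) [AddCommGroup X]
    [Module (IwasawaAlgebraO S) X] [Module (padicCoeffIntegers S) X]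
    [IsScalarTower (padicCoeffIntegers S) (IwasawaAlgebraO S) X] [Module.Finite (IwasawaAlgebraO S) X]
    (toDual : X →+ (Sg →+ AddCircle (1 : ℚ))) (hbij : Function.Bijective toDual)
    (hC : ∀ (a : padicCoeffIntegers S) (x : X) (s : Sg),
      toDual ((PowerSeries.C a : IwasawaAlgebraO S) • x) s =
        toDual x ⟨scalarH1 κ.kerSubgroup (Cofree ρ (padicCoeffField S)) a s, hscal a s.2⟩)
    (ϖ : padicCoeffIntegers S) (hϖ : Irreducible ϖ)
    (hfin : {c : subgroupH1 κ.kerSubgroup (Cofree ρ (padicCoeffField S)) |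
        c ∈ Sg ∧ scalarH1 κ.kerSubgroup (Cofree ρ (padicCoeffField S)) ϖ c = 0}.Finite) :
    Module.Finite (padicCoeffIntegers S) X ∧
      Nat.card (padicCoeffIntegers S ⧸ Ideal.span {ϖ}) ^
          Module.finrank (padicCoeffIntegers S) (X ⧸ Submodule.torsion (padicCoeffIntegers S) X) ≤
        {c : subgroupH1 κ.kerSubgroup (Cofree ρ (padicCoeffField S)) |
          c ∈ Sg ∧ scalarH1 κ.kerSubgroup (Cofree ρ (padicCoeffField S)) ϖ c = 0}.ncard := by
  -- the constants in `𝒪`-form: `a • x = C a • x` along the scalar tower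
  have hC' : ∀ (a : padicCoeffIntegers S) (x : X) (s : Sg),
      toDual (a • x) s = toDual x ⟨scalarH1 κ.kerSubgroup (Cofree ρ (padicCoeffField S)) a s, hscal a s.2⟩ := by
    intro a x s
    rw [← IsScalarTower.algebraMap_smul (IwasawaAlgebraO S) a x]
    exact hC a x s
  have hcard := natCard_quotient_eq_ncard_of_dualPair S κ ρ Sg hscal X toDual hbij hC' ϖ
  -- `X/ϖX` is finite: its cardinality is that of a finite set containing `0`
  have hpos : 0 < {c : subgroupH1 κ.kerSubgroup (Cofree ρ (padicCoeffField S)) |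
      c ∈ Sg ∧ scalarH1 κ.kerSubgroup (Cofree ρ (padicCoeffField S)) ϖ c = 0}.ncard :=
    (Set.ncard_pos hfin).2 ⟨0, Sg.zero_mem, map_zero _⟩
  haveI : Finite (X ⧸ ((Ideal.span {ϖ} : Ideal (padicCoeffIntegers S)) •
      (⊤ : Submodule (padicCoeffIntegers S) X))) := by
    apply Nat.finite_of_card_ne_zero
    rw [hcard]
    exact hpos.ne'
  obtain ⟨hfg, hle⟩ := pow_finrank_le_natCard_quotient_of_iwasawaAlgebraO p S ϖ hϖ X
  exact ⟨hfg, hcard ▸ hle⟩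

omit Sg hscal κ ρ in
/-- **`q = #(𝒪/ϖ) ≥ 1`** for a uniformiser `ϖ` of `𝒪 = 𝒪_{ℚ_p(S)}` (`ℚ_p(S)/ℚ_p` finite): the residue field
`𝒪/ϖ = 𝒪/𝔪` is finite and nonempty (`𝒪_{ℚ_p(S)}` is a DVR with finite residue field — the bricks
`isDiscreteValuationRing_unitBall`, `finite_quotient_maximalIdeal_unitBall` of p624860, transported along
`padicCoeffIntegers_eq_unitBall`). [cite: NeukirchANT1999, Ch. II (4.8)] -/
theorem one_le_natCard_quotient_span_of_irreducible [FiniteDimensional ℚ_[p] (padicCoeffField S)] :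
    ∀ (ϖ : padicCoeffIntegers S), Irreducible ϖ → 1 ≤ Nat.card (padicCoeffIntegers S ⧸ Ideal.span {ϖ}) := by
  rw [padicCoeffIntegers_eq_unitBall S]
  intro ϖ hϖ
  haveI := isDiscreteValuationRing_unitBall p (padicCoeffField S)
  have hmax : IsLocalRing.maximalIdeal
      (Literature.NumberTheory.Automorphic.PadicIntermediateField.unitBall p (padicCoeffField S)) =
        Ideal.span {ϖ} :=
    (IsDiscreteValuationRing.irreducible_iff_uniformizer ϖ).1 hϖ
  haveI : Finite (Literature.NumberTheory.Automorphic.PadicIntermediateField.unitBall p (padicCoeffField S) ⧸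
      Ideal.span {ϖ}) := by
    rw [← hmax]
    exact finite_quotient_maximalIdeal_unitBall p (padicCoeffField S)
  exact Nat.one_le_iff_ne_zero.mpr Nat.card_pos.ne'

/-! ### §3. The shape S2 consumes: a scalar-stable subgroup of the counted set with a dual of large rank -/

include hscal in
/-- **`#(𝒪/ϖ)^m ≤ #{c ∈ 𝒮 | ϖ·c = 0}` from a dual of rank `≥ m` of a scalar-stable subgroup `Sg ⊆ 𝒮`.** For any
set `𝒮 ⊆ H¹(K_∞, A)` (in the crux: the transported `S₀`-imprimitive plus-Selmer set of `A_g` over `ℚ_∞`), any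
`𝒪`-stable additive subgroup `Sg` contained in `𝒮`, any finitely generated `Λ_𝒪`-module `X` Pontryagin-dual to
`Sg` with the constants acting through `scalarH1` (§2), any uniformiser `ϖ` and any `m ≤ rank_𝒪(X/X_tors)`:
if `{c ∈ 𝒮 | ϖ·c = 0}` is finite then `#(𝒪/ϖ)^m ≤ #{c ∈ 𝒮 | ϖ·c = 0}` (§2 for `Sg`, then monotonicity of
`Set.ncard` along `{c ∈ Sg | ϖ·c = 0} ⊆ {c ∈ 𝒮 | ϖ·c = 0}` and of `q^·`, `q = #(𝒪/ϖ) ≥ 1`). With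
`m = d + Σ_g(S₀)` and `𝒮` the skeleton's set this is the conclusion of S2 `stub_cmLambdaLower`: S2 is thereby
REDUCED to the `𝒪`-corank statement (f) of `LINE-DESIGN-g11.md` §2.
[cite: EmertonPollackWeston2006, Thm. 3.1.1] [cite: GreenbergLNM1716, §4 p. 98] -/
theorem pow_le_ncard_of_dualPair_of_subset [FiniteDimensional ℚ_[p] (padicCoeffField S)]
    (𝒮 : Set (subgroupH1 κ.kerSubgroup (Cofree ρ (padicCoeffField S))))
    (hSg : (Sg : Set (subgroupH1 κ.kerSubgroup (Cofree ρ (padicCoeffField S)))) ⊆ 𝒮)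
    (X : Type w) [AddCommGroup X]
    [Module (IwasawaAlgebraO S) X] [Module (padicCoeffIntegers S) X]
    [IsScalarTower (padicCoeffIntegers S) (IwasawaAlgebraO S) X] [Module.Finite (IwasawaAlgebraO S) X]
    (toDual : X →+ (Sg →+ AddCircle (1 : ℚ))) (hbij : Function.Bijective toDual)
    (hC : ∀ (a : padicCoeffIntegers S) (x : X) (s : Sg),
      toDual ((PowerSeries.C a : IwasawaAlgebraO S) • x) s =
        toDual x ⟨scalarH1 κ.kerSubgroup (Cofree ρ (padicCoeffField S)) a s, hscal a s.2⟩)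
    (ϖ : padicCoeffIntegers S) (hϖ : Irreducible ϖ) (m : ℕ)
    (hm : m ≤ Module.finrank (padicCoeffIntegers S) (X ⧸ Submodule.torsion (padicCoeffIntegers S) X))
    (hfin : {c : subgroupH1 κ.kerSubgroup (Cofree ρ (padicCoeffField S)) |
        c ∈ 𝒮 ∧ scalarH1 κ.kerSubgroup (Cofree ρ (padicCoeffField S)) ϖ c = 0}.Finite) :
    Nat.card (padicCoeffIntegers S ⧸ Ideal.span {ϖ}) ^ m ≤
      {c : subgroupH1 κ.kerSubgroup (Cofree ρ (padicCoeffField S)) |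
        c ∈ 𝒮 ∧ scalarH1 κ.kerSubgroup (Cofree ρ (padicCoeffField S)) ϖ c = 0}.ncard := by
  have hsub : {c : subgroupH1 κ.kerSubgroup (Cofree ρ (padicCoeffField S)) |
        c ∈ Sg ∧ scalarH1 κ.kerSubgroup (Cofree ρ (padicCoeffField S)) ϖ c = 0} ⊆
      {c : subgroupH1 κ.kerSubgroup (Cofree ρ (padicCoeffField S)) |
        c ∈ 𝒮 ∧ scalarH1 κ.kerSubgroup (Cofree ρ (padicCoeffField S)) ϖ c = 0} :=
    fun c hc ↦ ⟨hSg hc.1, hc.2⟩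
  obtain ⟨-, hle⟩ := pow_finrank_le_ncard_of_dualPair S κ ρ Sg hscal X toDual hbij hC ϖ hϖ
    (hfin.subset hsub)
  have hq := one_le_natCard_quotient_span_of_irreducible (p := p) S ϖ hϖ
  calc Nat.card (padicCoeffIntegers S ⧸ Ideal.span {ϖ}) ^ m
      ≤ Nat.card (padicCoeffIntegers S ⧸ Ideal.span {ϖ}) ^
          Module.finrank (padicCoeffIntegers S) (X ⧸ Submodule.torsion (padicCoeffIntegers S) X) :=
        Nat.pow_le_pow_right hq hm
    _ ≤ _ := hle
    _ ≤ _ := Set.ncard_le_ncard hsub hfin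

end DualPair

/-! ### §4. Non-vacuity: the `Λ_𝒪`-dual of a `conj_γ`- and scalar-stable subgroup exists -/

section Exists

variable {p : ℕ} [Fact p.Prime]

set_option maxHeartbeats 800000 in
/-- **The `Λ_𝒪`-dual of a stable subgroup of `H¹(K_∞, A)` exists.** For `K` a number field, `𝒪 = 𝒪_{ℚ_p(S)}`,
`ρ : Γ_K → GL_n(𝒪)` framed, a `ℤ_p`-extension `κ` with topological generator `γ`, and an additive subgroup
`Sg ≤ H¹(K_∞, A)` (`A = Fⁿ/𝒪ⁿ`) stable under `conj_γ` and under the scalars `𝒪`: the Pontryagin dual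
`X = Hom(Sg, ℚ/ℤ)` carries a `Λ_𝒪 = 𝒪⟦T⟧`-module structure in which `T` acts as `conj_γ − 1` and the constant
`C a` as the transpose of `scalarH1 a`, and — with the `𝒪`-structure restricted along `𝒪 → 𝒪⟦T⟧` — a scalar
tower `𝒪 → Λ_𝒪 → X`; in particular the dual-pair hypotheses of §1–§3 (with `toDual = id`) are inhabited for
every such `Sg`. This is the tree's `GreenbergSelmer.nonempty_dualData` (Greenberg 1989 §1; Greenberg 1999 §1
PDF p. 60 «every element of which is killed by `Tⁿ` for some `n` … a `Λ`-submodule»; EPW §3.1) with Greenberg's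
Selmer group replaced by an arbitrary stable subgroup: `conj_γ − 1` is locally nilpotent on `Sg` ((P), (A2) of
`GreenbergSelmerDualDataExistsProofs` and `IwasawaDual.pow_mul_prime_pow_apply_eq_zero`), the scalars form a ring
action commuting with it, and `IwasawaDualCoeff.exists_module` applies.
[cite: Greenberg1989, §1 p. 98] [cite: GreenbergLNM1716, §1 (after Conj. 1.3)]
[cite: EmertonPollackWeston2006, §3.1 (arXiv:math/0404484 p. 17)] -/
theorem exists_dualPair_of_stable {K : Type} [Field K] [NumberField K] (S : Set (PadicAlgCl p)) {n : ℕ}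
    (κ : ZpExtension K p) {γ : absoluteGaloisGroup K} (hγ : κ.IsTopGenerator γ)
    (ρ : FramedGaloisRep K (padicCoeffIntegers S) n)
    (Sg : AddSubgroup (subgroupH1 κ.kerSubgroup (Cofree ρ (padicCoeffField S))))
    (hconj : ∀ {c : subgroupH1 κ.kerSubgroup (Cofree ρ (padicCoeffField S))},
      c ∈ Sg → conjH1 κ.kerSubgroup (Cofree ρ (padicCoeffField S)) γ c ∈ Sg)
    (hscal : ∀ (r : padicCoeffIntegers S) {c : subgroupH1 κ.kerSubgroup (Cofree ρ (padicCoeffField S))},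
      c ∈ Sg → scalarH1 κ.kerSubgroup (Cofree ρ (padicCoeffField S)) r c ∈ Sg) :
    ∃ instΛ : Module (IwasawaAlgebraO S) (Sg →+ AddCircle (1 : ℚ)),
      ∃ inst𝒪 : Module (padicCoeffIntegers S) (Sg →+ AddCircle (1 : ℚ)),
        (letI := instΛ; letI := inst𝒪;
          IsScalarTower (padicCoeffIntegers S) (IwasawaAlgebraO S) (Sg →+ AddCircle (1 : ℚ))) ∧
        (∀ (x : Sg →+ AddCircle (1 : ℚ)) (s : Sg),
          (letI := instΛ; (PowerSeries.X : IwasawaAlgebraO S) • x) s =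
            x ⟨conjH1 κ.kerSubgroup (Cofree ρ (padicCoeffField S)) γ s, hconj s.2⟩ - x s) ∧
        (∀ (a : padicCoeffIntegers S) (x : Sg →+ AddCircle (1 : ℚ)) (s : Sg),
          (letI := instΛ; (PowerSeries.C a : IwasawaAlgebraO S) • x) s =
            x ⟨scalarH1 κ.kerSubgroup (Cofree ρ (padicCoeffField S)) a s, hscal a s.2⟩) := by
  classical
  -- pointwise calculus in `End(Sg)` (definitional)
  have hsub : ∀ (f g : AddMonoid.End Sg) (s : Sg), (f - g) s = f s - g s := fun _ _ _ ↦ rfl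
  have hone : ∀ s : Sg, (1 : AddMonoid.End Sg) s = s := fun _ ↦ rfl
  have hmul : ∀ (f g : AddMonoid.End Sg) (s : Sg), (f * g) s = f (g s) := fun _ _ _ ↦ rfl
  -- `conj_γ` restricted to `Sg`, kept opaque
  obtain ⟨cγ, hcγ⟩ : ∃ c : AddMonoid.End Sg, ∀ s : Sg,
      ((c s : Sg) : subgroupH1 κ.kerSubgroup (Cofree ρ (padicCoeffField S))) =
        conjH1 κ.kerSubgroup (Cofree ρ (padicCoeffField S)) γ s :=
    ⟨((conjH1 κ.kerSubgroup (Cofree ρ (padicCoeffField S)) γ).restrict Sg).codRestrict Sg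
        fun s ↦ hconj s.2, fun _ ↦ rfl⟩
  -- the scalars restricted to `Sg`, as a ring action, kept opaque
  obtain ⟨σ, hσ⟩ : ∃ σ : padicCoeffIntegers S →+* AddMonoid.End Sg,
      ∀ (r : padicCoeffIntegers S) (s : Sg),
        ((σ r s : Sg) : subgroupH1 κ.kerSubgroup (Cofree ρ (padicCoeffField S))) =
          scalarH1 κ.kerSubgroup (Cofree ρ (padicCoeffField S)) r s := by
    refine ⟨{ toFun := fun r ↦ ((scalarH1 κ.kerSubgroup (Cofree ρ (padicCoeffField S)) r).restrict
                  Sg).codRestrict Sg fun s ↦ hscal r s.2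
              map_one' := ?_, map_mul' := ?_, map_zero' := ?_, map_add' := ?_ }, fun _ _ ↦ rfl⟩
    · refine DFunLike.ext _ _ fun s ↦ Subtype.ext ?_
      exact DFunLike.congr_fun (scalarH1_one κ.kerSubgroup (Cofree ρ (padicCoeffField S))
        (R := padicCoeffIntegers S)) (s : subgroupH1 κ.kerSubgroup (Cofree ρ (padicCoeffField S)))
    · intro r r'
      refine DFunLike.ext _ _ fun s ↦ Subtype.ext ?_
      exact DFunLike.congr_fun (scalarH1_mul κ.kerSubgroup (Cofree ρ (padicCoeffField S)) r r')
        (s : subgroupH1 κ.kerSubgroup (Cofree ρ (padicCoeffField S)))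
    · refine DFunLike.ext _ _ fun s ↦ Subtype.ext ?_
      exact DFunLike.congr_fun (scalarH1_zero κ.kerSubgroup (Cofree ρ (padicCoeffField S))
        (R := padicCoeffIntegers S)) (s : subgroupH1 κ.kerSubgroup (Cofree ρ (padicCoeffField S)))
    · intro r r'
      refine DFunLike.ext _ _ fun s ↦ Subtype.ext ?_
      exact DFunLike.congr_fun (scalarH1_add κ.kerSubgroup (Cofree ρ (padicCoeffField S)) r r')
        (s : subgroupH1 κ.kerSubgroup (Cofree ρ (padicCoeffField S)))
  -- powers of `cγ` are the restrictions of `conj_{γ^m}`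
  have cγ_pow : ∀ (m : ℕ) (s : Sg),
      (((cγ ^ m) s : Sg) : subgroupH1 κ.kerSubgroup (Cofree ρ (padicCoeffField S))) =
        conjH1 κ.kerSubgroup (Cofree ρ (padicCoeffField S)) (γ ^ m) s := by
    intro m
    induction m with
    | zero =>
      intro s
      rw [pow_zero, pow_zero, hone, conjH1_one_holds κ.kerSubgroup (Cofree ρ (padicCoeffField S)),
        AddMonoidHom.id_apply]
    | succ m ih =>
      intro s
      rw [pow_succ, hmul, ih, hcγ, pow_succ,
        conjH1_mul_holds κ.kerSubgroup (Cofree ρ (padicCoeffField S)), AddMonoidHom.comp_apply]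
  -- `conj_γ - 1` commutes with the scalars (`conjH1_comp_scalarH1`)
  have hcomm : ∀ r : padicCoeffIntegers S, (cγ - 1) * σ r = σ r * (cγ - 1) := by
    intro r
    refine DFunLike.ext _ _ fun s ↦ ?_
    rw [hmul, hmul, hsub, hsub, hone, hone, map_sub]
    congr 1
    refine Subtype.ext ?_
    rw [hcγ, hσ, hσ, hcγ]
    exact DFunLike.congr_fun
      (conjH1_comp_scalarH1 (M := Cofree ρ (padicCoeffField S)) κ.kerSubgroup γ r)
      (s : subgroupH1 κ.kerSubgroup (Cofree ρ (padicCoeffField S)))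
  -- `conj_γ - 1` is locally nilpotent on `Sg`: (P), (A2) and the algebra lemma
  have hnil : ∀ s : Sg, ∃ N : ℕ, ((cγ - 1) ^ N) s = 0 := by
    intro s
    obtain ⟨a, ha⟩ := exists_conjH1_pow_prime_pow_eq κ (Cofree ρ (padicCoeffField S))
      (isOpen_stabilizer_cofree S ρ) hγ
      (s : subgroupH1 κ.kerSubgroup (Cofree ρ (padicCoeffField S)))
    obtain ⟨k, hk⟩ := exists_pow_smul_subgroupH1_eq_zero κ (Cofree ρ (padicCoeffField S))
      (exists_pow_smul_cofree_eq_zero S ρ)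
      (s : subgroupH1 κ.kerSubgroup (Cofree ρ (padicCoeffField S)))
    have hφ : (cγ ^ p ^ a) s = s := Subtype.ext (by rw [cγ_pow]; exact ha)
    have hk' : p ^ k • s = 0 := Subtype.ext (by rw [AddSubgroupClass.coe_nsmul]; exact hk)
    exact ⟨k * p ^ a, IwasawaDual.pow_mul_prime_pow_apply_eq_zero (Fact.out : p.Prime) cγ a hφ hk'⟩
  -- the `Λ_𝒪`-module structure on the dual
  obtain ⟨inst, -, hX, hC⟩ := IwasawaDualCoeff.exists_module hcomm hnil (AddCircle (1 : ℚ))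
  letI : Module (IwasawaAlgebraO S) (Sg →+ AddCircle (1 : ℚ)) := inst
  -- the `𝒪`-structure along `𝒪 → 𝒪⟦T⟧` (kept opaque: introduced by `Exists.elim`, not `obtain`) and the tower
  have hh : ∃ inst𝒪 : Module (padicCoeffIntegers S) (Sg →+ AddCircle (1 : ℚ)),
      ∀ (a : padicCoeffIntegers S) (x : Sg →+ AddCircle (1 : ℚ)),
        (letI := inst𝒪; a • x) = (algebraMap (padicCoeffIntegers S) (IwasawaAlgebraO S) a) • x :=
    ⟨Module.compHom (Sg →+ AddCircle (1 : ℚ)) (algebraMap (padicCoeffIntegers S) (IwasawaAlgebraO S)),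
      fun _ _ ↦ rfl⟩
  refine hh.elim fun inst𝒪 h𝒪 ↦ ?_
  have htower : (letI := inst𝒪;
      IsScalarTower (padicCoeffIntegers S) (IwasawaAlgebraO S) (Sg →+ AddCircle (1 : ℚ))) := by
    letI := inst𝒪
    exact IsScalarTower.of_algebraMap_smul fun r x ↦ (h𝒪 r x).symm
  refine ⟨inst, inst𝒪, htower, fun x s ↦ ?_, fun a x s ↦ ?_⟩
  · -- `(T • x) s = x (conj_γ s) - x s`, by exact terms (no `rw`: keeps `subgroupH1` folded)
    have h1 : (letI := inst; (PowerSeries.X : IwasawaAlgebraO S) • x) s = x (cγ s - s) := hX x s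
    have h2 : cγ s = ⟨conjH1 κ.kerSubgroup (Cofree ρ (padicCoeffField S)) γ s, hconj s.2⟩ :=
      Subtype.ext (hcγ s)
    exact h1.trans ((map_sub x (cγ s) s).trans (congrArg (fun t : Sg ↦ x t - x s) h2))
  · -- `(C a • x) s = x (a · s)`
    have h1 : (letI := inst; (PowerSeries.C a : IwasawaAlgebraO S) • x) s = x (σ a s) := hC a x s
    have h2 : σ a s = ⟨scalarH1 κ.kerSubgroup (Cofree ρ (padicCoeffField S)) a s, hscal a s.2⟩ :=
      Subtype.ext (hσ a s)
    exact h1.trans (congrArg x h2)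

end Exists

end Summit.BirchSwinnertonDyer.BirchSwinnertonDyer.Theorems.LambdaLowerBoundO

end
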